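import Summits.ValiantsHypothesis.ValiantsHypothesis.Theorems.LacunarySymmetroidMatrixDescartesChainJunction
import Summits.ValiantsHypothesis.ValiantsHypothesis.Theorems.LacunarySymmetroidMatrixDescartesGraftLawFloor
import Summits.ValiantsHypothesis.ValiantsHypothesis.Theorems.LacunarySymmetroidMatrixDescartesGraftBorderAny

/-!
# `MatrixDescartes` census — THE CHAIN LAW: reversal, self-chain, and `ζ_sym(m,7) ≥ 2m² + 4m` for every `m`

HONEST FRAMING.  Object-search cell `pub-symmetroid`, crux `Theses.LacunarySymmetroid.MatrixDescartes`
(stmt-ValiantsHypothesis-18050); seat val-sym-mdr-p1 (g8); the desk's «CHAIN LEMMA» kernel target (R1909 (3) / R1987 (A)).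
LOWER-bound / construction mathematics in census (CONJECTURE-A) currency; it proves NOTHING about the crux `MatrixDescartes`
(an UPPER-bound statement at fat formats), nothing about `DoorA26` / `DoorA34`, nothing about `VP ≠ VNP`.  No definitions.

* REVERSAL (`exists_alternating_reverse`): the substitution `x ↦ 1/x` (tree `Census.det_pencil_mirror_eval`) turns an alternation
  certificate of `∑ X^(d l) • S l` (strictly increasing support) into one of `∑ X^(d last − d (rev l)) • S (rev l)` along the
  reciprocal points in reverse order — same letters, same number of alternations, and the BOTTOM letter of the reversal is the TOP
  letter of the source.
* SELF-CHAIN (`exists_alternating_chain`): hence the junction law (`Chain.exists_alternating_junction`, companion file) applies to a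
  certificate and its own reversal with NO inertia matching: `(K+1 letters, N alternations) ⇒ (2K+1 letters, 2N alternations)`,
  top letter of the chain ∝ bottom letter of the source; iterated, `(2ⁿK + 1 letters, 2ⁿN alternations)` (`exists_alternating_chain_pow`).
* HEADLINE (`not_posRootLawAt_seven`): from the seat's `K = 4` base (`Graft.exists_alternating_four`: `(m+1)² − 1` alternations, g2/g3)
  **`¬ PosRootLawAt m 7 (2(m+1)² − 3)` for every `m ≥ 1`, i.e. `ζ_sym(m,7) ≥ 2m² + 4m`** (the graft floor gave `m² + 5m`; new kernel
  rows `(6,7) ≥ 96`, `(7,7) ≥ 126`, `(8,7) ≥ 160`, …; for `m ≤ 5` the chained census certificates of the companion ray files are stronger); `ζ_sym(m, 3·2ⁿ + 1) ≥ 2ⁿ(m² + 2m)` (`not_posRootLawAt_chain_pow`,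
  e.g. `(m,13) ≥ 4m² + 8m`), and the grafted ray `ζ_sym(m, 7 + i) ≥ 2m² + (4 + i)m` (`not_posRootLawAt_seven_add`).
Paper source of the construction: conjb-1 g6 ROUND-6 memo §3 (cell bus l.8126; «ζ_sym(m, 2K−1) ≥ 2·ζ_witness(m,K)»).  [folklore]
-/

-- `Summit.ValiantsHypothesis.ValiantsHypothesis.…` repeats a component by the D-0017 layout
-- (single-conjunct summit), which the `dupNamespace` linter flags; the name is mandated.
set_option linter.dupNamespace false

namespace Summit.ValiantsHypothesis.ValiantsHypothesis.Theorems.LacunarySymmetroidMatrixDescartes.Census.Chain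

open Matrix Finset Filter Topology
open scoped BigOperators
open Summit.ValiantsHypothesis.ValiantsHypothesis.Theorems.LacunarySymmetroidMatrixDescartes.Census.Graft
open Summit.ValiantsHypothesis.ValiantsHypothesis.Theorems.MatrixDescartes.Negative (PosRootLawAt)

/-! ### Reversal of a certificate (`x ↦ 1/x`) -/

/-- **REVERSAL of an alternation certificate.**  If `∑ X^(d l) • S l` (strictly increasing support) alternates along
`0 < τ 0 < ⋯ < τ N`, then `∑ X^(d last − d (rev l)) • S (rev l)` — the same letters in reverse order on the mirrored support,
again strictly increasing and starting at exponent `0` with the source's TOP letter — alternates along the reciprocal points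
`(τ N)⁻¹ < ⋯ < (τ 0)⁻¹` (at `x > 0` the two determinants differ by the positive factor `x^(m·d last)`, tree
`Census.det_pencil_mirror_eval`). [folklore] -/
theorem exists_alternating_reverse {m K N : ℕ} (d : Fin (K + 1) → ℕ) (S : Fin (K + 1) → Matrix (Fin m) (Fin m) ℝ)
    (hd : StrictMono d) (hS : ∀ l, (S l).IsSymm) (τ : Fin (N + 1) → ℝ) (hτ : StrictMono τ) (hpos : ∀ j, 0 < τ j)
    (hne : ∀ j, (∑ l, τ j ^ d l • S l).det ≠ 0)
    (halt : ∀ j : Fin N, (∑ l, τ j.castSucc ^ d l • S l).det * (∑ l, τ j.succ ^ d l • S l).det < 0) :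
    ∃ (d' : Fin (K + 1) → ℕ) (S' : Fin (K + 1) → Matrix (Fin m) (Fin m) ℝ) (τ' : Fin (N + 1) → ℝ),
      (∀ l, d' l = d (Fin.last K) - d (Fin.rev l)) ∧ (∀ l, S' l = S (Fin.rev l)) ∧
      (∀ j, τ' j = (τ (Fin.rev j))⁻¹) ∧
      StrictMono d' ∧ (∀ l, (S' l).IsSymm) ∧ StrictMono τ' ∧ (∀ j, 0 < τ' j) ∧
      (∀ j, (∑ l, τ' j ^ d' l • S' l).det ≠ 0) ∧
      ∀ j : Fin N, (∑ l, τ' j.castSucc ^ d' l • S' l).det * (∑ l, τ' j.succ ^ d' l • S' l).det < 0 := by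
  have hdle : ∀ l, d l ≤ d (Fin.last K) := fun l => hd.monotone (Fin.le_last l)
  -- the evaluation identity of the reversed pencil at `x ≠ 0`
  have hev : ∀ x : ℝ, x ≠ 0 →
      (∑ l, x ^ (d (Fin.last K) - d (Fin.rev l)) • S (Fin.rev l)).det
        = (x ^ d (Fin.last K)) ^ m * (∑ l, x⁻¹ ^ d l • S l).det := by
    intro x hx
    have hre : ∑ l, x ^ (d (Fin.last K) - d (Fin.rev l)) • S (Fin.rev l)
        = ∑ l, x ^ (d (Fin.last K) - d l) • S l := by
      have h := Equiv.sum_comp Fin.revPerm (fun l => x ^ (d (Fin.last K) - d l) • S l)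
      simpa only [Fin.revPerm_apply] using h
    rw [hre]
    exact det_pencil_mirror_eval d (d (Fin.last K)) hdle S x hx
  refine ⟨fun l => d (Fin.last K) - d (Fin.rev l), fun l => S (Fin.rev l), fun j => (τ (Fin.rev j))⁻¹,
    fun l => rfl, fun l => rfl, fun j => rfl, ?_, fun l => hS _, ?_, fun j => inv_pos.mpr (hpos _), ?_, ?_⟩
  · intro l l' h
    have h1 : d (Fin.rev l') < d (Fin.rev l) := hd (Fin.rev_lt_rev.mpr h)
    have h2 := hdle (Fin.rev l)
    show d (Fin.last K) - d (Fin.rev l) < d (Fin.last K) - d (Fin.rev l')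
    omega
  · intro j j' h
    show (τ (Fin.rev j))⁻¹ < (τ (Fin.rev j'))⁻¹
    exact (inv_lt_inv₀ (hpos _) (hpos _)).mpr (hτ (Fin.rev_lt_rev.mpr h))
  · intro j
    show (∑ l, (τ (Fin.rev j))⁻¹ ^ (d (Fin.last K) - d (Fin.rev l)) • S (Fin.rev l)).det ≠ 0
    rw [hev _ (inv_ne_zero (hpos _).ne'), inv_inv]
    exact mul_ne_zero (pow_ne_zero _ (pow_ne_zero _ (inv_ne_zero (hpos _).ne'))) (hne _)
  · intro j
    show (∑ l, (τ (Fin.rev j.castSucc))⁻¹ ^ (d (Fin.last K) - d (Fin.rev l)) • S (Fin.rev l)).det *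
        (∑ l, (τ (Fin.rev j.succ))⁻¹ ^ (d (Fin.last K) - d (Fin.rev l)) • S (Fin.rev l)).det < 0
    rw [hev _ (inv_ne_zero (hpos _).ne'), hev _ (inv_ne_zero (hpos _).ne'), inv_inv, inv_inv,
      Fin.rev_castSucc, Fin.rev_succ]
    have h := halt (Fin.rev j)
    have h1 : 0 < ((τ (Fin.rev j).succ)⁻¹ ^ d (Fin.last K)) ^ m :=
      pow_pos (pow_pos (inv_pos.mpr (hpos _)) _) _
    have h2 : 0 < ((τ (Fin.rev j).castSucc)⁻¹ ^ d (Fin.last K)) ^ m :=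
      pow_pos (pow_pos (inv_pos.mpr (hpos _)) _) _
    have hrw : ((τ (Fin.rev j).succ)⁻¹ ^ d (Fin.last K)) ^ m * (∑ l, τ (Fin.rev j).succ ^ d l • S l).det *
        (((τ (Fin.rev j).castSucc)⁻¹ ^ d (Fin.last K)) ^ m * (∑ l, τ (Fin.rev j).castSucc ^ d l • S l).det)
        = (((τ (Fin.rev j).succ)⁻¹ ^ d (Fin.last K)) ^ m * ((τ (Fin.rev j).castSucc)⁻¹ ^ d (Fin.last K)) ^ m) *
          ((∑ l, τ (Fin.rev j).castSucc ^ d l • S l).det * (∑ l, τ (Fin.rev j).succ ^ d l • S l).det) := by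
      ring
    rw [hrw]
    exact mul_neg_of_pos_of_neg (mul_pos h1 h2) h

/-! ### The self-chain -/

/-- **THE SELF-CHAIN (all formats).**  An alternation certificate with `K+1` letters on a strictly increasing support and `N`
alternations, chained with its own reversal through the shared top letter (`Chain.exists_alternating_junction`; the bottom letter of
the reversal IS the top letter of the source, so no inertia matching is needed), gives a certificate with `K + 1 + K` letters on a
strictly increasing support and `N + N` alternations.  The source letters are kept verbatim; the appended letters are positive
multiples of the source letters in reverse order (`S (rev l.succ)`, `l < K`), at exponents `d last + (d last − d (rev l.succ))`; in
particular the top letter of the chain is a positive multiple of the source's bottom letter `S 0`.  In census words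
`ζ_sym(m, 2K+1) ≥ 2·ζ_alt(m, K+1)`. [folklore] -/
theorem exists_alternating_chain {m K N : ℕ} (d : Fin (K + 1) → ℕ) (S : Fin (K + 1) → Matrix (Fin m) (Fin m) ℝ)
    (hd : StrictMono d) (hS : ∀ l, (S l).IsSymm) (τ : Fin (N + 1) → ℝ) (hτ : StrictMono τ) (hpos : ∀ j, 0 < τ j)
    (hne : ∀ j, (∑ l, τ j ^ d l • S l).det ≠ 0)
    (halt : ∀ j : Fin N, (∑ l, τ j.castSucc ^ d l • S l).det * (∑ l, τ j.succ ^ d l • S l).det < 0) :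
    ∃ (d' : Fin (K + 1 + K) → ℕ) (S' : Fin (K + 1 + K) → Matrix (Fin m) (Fin m) ℝ) (τ' : Fin (N + N + 1) → ℝ),
      StrictMono d' ∧ (∀ i : Fin (K + 1), d' (Fin.castAdd K i) = d i ∧ S' (Fin.castAdd K i) = S i) ∧
      (∃ Λ : ℝ, 0 < Λ ∧ ∀ l : Fin K,
        d' (Fin.natAdd (K + 1) l) = d (Fin.last K) + (d (Fin.last K) - d (Fin.rev l.succ)) ∧
        S' (Fin.natAdd (K + 1) l) = (Λ ^ (d (Fin.last K) - d (Fin.rev l.succ)))⁻¹ • S (Fin.rev l.succ)) ∧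
      (∀ l, (S' l).IsSymm) ∧ StrictMono τ' ∧ (∀ j, 0 < τ' j) ∧
      (∀ j, (∑ l, τ' j ^ d' l • S' l).det ≠ 0) ∧
      ∀ j : Fin (N + N), (∑ l, τ' j.castSucc ^ d' l • S' l).det * (∑ l, τ' j.succ ^ d' l • S' l).det < 0 := by
  obtain ⟨e, T, σ, he', hT', -, he, hT, hσ, hσpos, hne', halt'⟩ :=
    exists_alternating_reverse d S hd hS τ hτ hpos hne halt
  have hJ : T 0 = S (Fin.last K) := by rw [hT', Fin.rev_zero]
  obtain ⟨d', S', τ', hd', hold, ⟨Λ, hΛ, hnew⟩, hS', hτ', hpos', hne'', halt''⟩ :=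
    exists_alternating_junction d S hd hS τ hτ hpos hne halt e T he hT σ hσ hσpos hne' halt' hJ
  have he0 : e 0 = 0 := by rw [he', Fin.rev_zero, Nat.sub_self]
  refine ⟨d', S', τ', hd', hold, ⟨Λ, hΛ, fun l => ⟨?_, ?_⟩⟩, hS', hτ', hpos', hne'', halt''⟩
  · rw [(hnew l).1, he', he0, Nat.sub_zero]
  · rw [(hnew l).2, he', hT', he0, Nat.sub_zero]

/-- Transport of a strictly-supported alternation certificate along equalities of the letter count and of the alternation count
(bookkeeping). [folklore] -/
theorem certificate_transport {m K K' N N' : ℕ} (hK : K = K') (hN : N = N')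
    (h : ∃ (d : Fin K → ℕ) (S : Fin K → Matrix (Fin m) (Fin m) ℝ) (τ : Fin (N + 1) → ℝ),
      StrictMono d ∧ (∀ l, (S l).IsSymm) ∧ StrictMono τ ∧ (∀ j, 0 < τ j) ∧ (∀ j, (∑ l, τ j ^ d l • S l).det ≠ 0) ∧
      ∀ j : Fin N, (∑ l, τ j.castSucc ^ d l • S l).det * (∑ l, τ j.succ ^ d l • S l).det < 0) :
    ∃ (d : Fin K' → ℕ) (S : Fin K' → Matrix (Fin m) (Fin m) ℝ) (τ : Fin (N' + 1) → ℝ),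
      StrictMono d ∧ (∀ l, (S l).IsSymm) ∧ StrictMono τ ∧ (∀ j, 0 < τ j) ∧ (∀ j, (∑ l, τ j ^ d l • S l).det ≠ 0) ∧
      ∀ j : Fin N', (∑ l, τ j.castSucc ^ d l • S l).det * (∑ l, τ j.succ ^ d l • S l).det < 0 := by
  subst hK hN
  exact h

/-- **The self-chain in certificate shape**: `(K+1 letters, strictly increasing support, N alternations) ⇒
(2K+1 letters, strictly increasing support, 2N alternations)`. [folklore] -/
theorem exists_alternating_chain' {m K N : ℕ}
    (h : ∃ (d : Fin (K + 1) → ℕ) (S : Fin (K + 1) → Matrix (Fin m) (Fin m) ℝ) (τ : Fin (N + 1) → ℝ),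
      StrictMono d ∧ (∀ l, (S l).IsSymm) ∧ StrictMono τ ∧ (∀ j, 0 < τ j) ∧ (∀ j, (∑ l, τ j ^ d l • S l).det ≠ 0) ∧
      ∀ j : Fin N, (∑ l, τ j.castSucc ^ d l • S l).det * (∑ l, τ j.succ ^ d l • S l).det < 0) :
    ∃ (d : Fin (2 * K + 1) → ℕ) (S : Fin (2 * K + 1) → Matrix (Fin m) (Fin m) ℝ) (τ : Fin (2 * N + 1) → ℝ),
      StrictMono d ∧ (∀ l, (S l).IsSymm) ∧ StrictMono τ ∧ (∀ j, 0 < τ j) ∧ (∀ j, (∑ l, τ j ^ d l • S l).det ≠ 0) ∧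
      ∀ j : Fin (2 * N), (∑ l, τ j.castSucc ^ d l • S l).det * (∑ l, τ j.succ ^ d l • S l).det < 0 := by
  obtain ⟨d, S, τ, hd, hS, hτ, hpos, hne, halt⟩ := h
  obtain ⟨d', S', τ', hd', -, -, hS', hτ', hpos', hne', halt'⟩ := exists_alternating_chain d S hd hS τ hτ hpos hne halt
  exact certificate_transport (by ring) (by ring) ⟨d', S', τ', hd', hS', hτ', hpos', hne', halt'⟩

/-- **The self-chain iterated `n` times**: `(K+1 letters, N alternations) ⇒ (2ⁿ·K + 1 letters, 2ⁿ·N alternations)` on strictly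
increasing supports — `ζ_sym(m, 2ⁿK + 1) ≥ 2ⁿ·ζ_alt(m, K+1)`. [folklore] -/
theorem exists_alternating_chain_pow {m K N : ℕ}
    (h : ∃ (d : Fin (K + 1) → ℕ) (S : Fin (K + 1) → Matrix (Fin m) (Fin m) ℝ) (τ : Fin (N + 1) → ℝ),
      StrictMono d ∧ (∀ l, (S l).IsSymm) ∧ StrictMono τ ∧ (∀ j, 0 < τ j) ∧ (∀ j, (∑ l, τ j ^ d l • S l).det ≠ 0) ∧
      ∀ j : Fin N, (∑ l, τ j.castSucc ^ d l • S l).det * (∑ l, τ j.succ ^ d l • S l).det < 0) (n : ℕ) :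
    ∃ (d : Fin (2 ^ n * K + 1) → ℕ) (S : Fin (2 ^ n * K + 1) → Matrix (Fin m) (Fin m) ℝ)
      (τ : Fin (2 ^ n * N + 1) → ℝ),
      StrictMono d ∧ (∀ l, (S l).IsSymm) ∧ StrictMono τ ∧ (∀ j, 0 < τ j) ∧ (∀ j, (∑ l, τ j ^ d l • S l).det ≠ 0) ∧
      ∀ j : Fin (2 ^ n * N), (∑ l, τ j.castSucc ^ d l • S l).det * (∑ l, τ j.succ ^ d l • S l).det < 0 := by
  induction n with
  | zero => exact certificate_transport (by ring) (by ring) h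
  | succ n ih => exact certificate_transport (by ring) (by ring) (exists_alternating_chain' ih)

/-! ### Rows -/

/-- **Certificate ⇒ chained row.**  Any alternation certificate with `K+1` letters (any support) and `N ≥ 1` alternations at size
`m` refutes the row `PosRootLawAt m (2K+1) (2N − 1)`: some real symmetric `(2K+1)`-term `m × m` pencil has `2N` distinct positive
determinant roots (support normal form `Graft.exists_alternating_strictMono`, then the self-chain). [folklore] -/
theorem not_posRootLawAt_chain_of_certificate {m K N : ℕ} (hN : 1 ≤ N) (d : Fin (K + 1) → ℕ)
    (S : Fin (K + 1) → Matrix (Fin m) (Fin m) ℝ) (hS : ∀ l, (S l).IsSymm)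
    (τ : Fin (N + 1) → ℝ) (hτ : StrictMono τ) (hpos : ∀ j, 0 < τ j)
    (halt : ∀ j : Fin N, (∑ l, τ j.castSucc ^ d l • S l).det * (∑ l, τ j.succ ^ d l • S l).det < 0) :
    ¬ PosRootLawAt m (2 * K + 1) (2 * N - 1) := by
  have hne : ∀ j, (∑ l, τ j ^ d l • S l).det ≠ 0 :=
    ne_zero_of_alternating hN (fun j => (∑ l, τ j ^ d l • S l).det) halt
  obtain ⟨d₁, S₁, hd₁, hS₁, hne₁, halt₁⟩ := exists_alternating_strictMono d S hS τ hpos hne halt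
  obtain ⟨d', S', τ', -, hS', hτ', hpos', -, halt'⟩ :=
    exists_alternating_chain' ⟨d₁, S₁, τ, hd₁, hS₁, hτ, hpos, hne₁, halt₁⟩
  exact not_posRootLawAt_of_alternating (by omega) d' S' hS' τ' hτ' hpos' halt'

/-- **THE CHAIN LEMMA (desk target R1909 (3) / R1987 (A)): `ζ_sym(m,7) ≥ 2m² + 4m` for every `m ≥ 1`** —
`¬ PosRootLawAt m 7 (2(m+1)² − 3)`: some real symmetric `7`-term `m × m` lacunary pencil has `2(m+1)² − 2 = 2m² + 4m` distinct positive
determinant roots (the seat's `K = 4` two-sided Lagrange tower, `Graft.exists_alternating_four`, chained with its own reversal through the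
shared top letter).  The graft floor (`Graft.not_posRootLawAt_graft`) gave `m² + 5m` at `K = 7`; this row exceeds it from `m = 2` and
exceeds the census records from `m = 4` (`(3,7) ≥ 35` of `Graft.RayM3K7F35` stays above `30`).  A LOWER bound in census currency — nothing
about the crux `MatrixDescartes`. [folklore] -/
theorem not_posRootLawAt_seven (m : ℕ) (hm : 1 ≤ m) : ¬ PosRootLawAt m 7 (2 * (m + 1) ^ 2 - 3) := by
  obtain ⟨d, S, τ, hS, hτ, hpos, -, halt⟩ := exists_alternating_four m hm
  have hsq : 1 ≤ (m + 1) ^ 2 - 1 := by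
    have : 4 ≤ (m + 1) ^ 2 := by nlinarith
    omega
  have h := not_posRootLawAt_chain_of_certificate hsq d S hS τ hτ hpos halt
  have h7 : 2 * ((m + 1) ^ 2 - 1) - 1 = 2 * (m + 1) ^ 2 - 3 := by omega
  rw [h7] at h
  exact h

/-- **Iterated chains: `ζ_sym(m, 3·2ⁿ + 1) ≥ 2ⁿ(m² + 2m)` for every `m ≥ 1`, `n ≥ 0`** — `¬ PosRootLawAt m (3·2ⁿ + 1) (2ⁿ((m+1)² − 1) − 1)`
(the `K = 4` base chained with its reversal `n` times; `n = 1` is `not_posRootLawAt_seven`, `n = 2` reads `ζ_sym(m,13) ≥ 4m² + 8m`).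
[folklore] -/
theorem not_posRootLawAt_chain_pow (m n : ℕ) (hm : 1 ≤ m) :
    ¬ PosRootLawAt m (3 * 2 ^ n + 1) (2 ^ n * ((m + 1) ^ 2 - 1) - 1) := by
  obtain ⟨d, S, τ, hS, hτ, hpos, hne, halt⟩ := exists_alternating_four m hm
  have hsq : 1 ≤ (m + 1) ^ 2 - 1 := by
    have : 4 ≤ (m + 1) ^ 2 := by nlinarith
    omega
  obtain ⟨d₁, S₁, hd₁, hS₁, hne₁, halt₁⟩ := exists_alternating_strictMono d S hS τ hpos hne halt
  obtain ⟨d', S', τ', -, hS', hτ', hpos', -, halt'⟩ :=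
    exists_alternating_chain_pow ⟨d₁, S₁, τ, hd₁, hS₁, hτ, hpos, hne₁, halt₁⟩ n
  have hN : 1 ≤ 2 ^ n * ((m + 1) ^ 2 - 1) := le_trans hsq (Nat.le_mul_of_pos_left _ (by positivity))
  have h := not_posRootLawAt_of_alternating hN d' S' hS' τ' hτ' hpos' halt'
  rw [show 2 ^ n * 3 + 1 = 3 * 2 ^ n + 1 by ring] at h
  exact h

/-- **The chained row grafted: `ζ_sym(m, 7 + i) ≥ 2m² + (4 + i)·m` for every `m ≥ 1`, `i ≥ 0`** — `¬ PosRootLawAt m (7 + i)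
(2(m+1)² − 2 + i·m − 1)` (graft law `Graft.exists_alternating_add`: each further letter buys `m` further alternations). [folklore] -/
theorem not_posRootLawAt_seven_add (m i : ℕ) (hm : 1 ≤ m) :
    ¬ PosRootLawAt m (7 + i) (2 * (m + 1) ^ 2 - 2 + i * m - 1) := by
  obtain ⟨d, S, τ, hS, hτ, hpos, hne, halt⟩ := exists_alternating_four m hm
  have hsq : 1 ≤ (m + 1) ^ 2 - 1 := by
    have : 4 ≤ (m + 1) ^ 2 := by nlinarith
    omega
  obtain ⟨d₁, S₁, hd₁, hS₁, hne₁, halt₁⟩ := exists_alternating_strictMono d S hS τ hpos hne halt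
  obtain ⟨d', S', τ', -, hS', hτ', hpos', hne', halt'⟩ :=
    exists_alternating_chain' ⟨d₁, S₁, τ, hd₁, hS₁, hτ, hpos, hne₁, halt₁⟩
  obtain ⟨d'', S'', τ'', hS'', hτ'', hpos'', -, halt''⟩ :=
    exists_alternating_add ⟨d', S', τ', hS', hτ', hpos', hne', halt'⟩ i
  have hN : 1 ≤ 2 * ((m + 1) ^ 2 - 1) + i * m := by omega
  have h := not_posRootLawAt_of_alternating hN d'' S'' hS'' τ'' hτ'' hpos'' halt''
  have hB : 2 * ((m + 1) ^ 2 - 1) + i * m - 1 = 2 * (m + 1) ^ 2 - 2 + i * m - 1 := by omega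
  rw [hB] at h
  exact h

/-! ### Numeral rows (census format `(m,K) ≥ B + 1` reads `¬ PosRootLawAt m K B`; sizes without census certificates —
for `m ≤ 5` the chained census certificates of the companion ray files are stronger) -/

/-- `ζ_sym(6,7) ≥ 96` (graft floor: `66`). [folklore] -/
theorem row_6_7 : ¬ PosRootLawAt 6 7 95 := not_posRootLawAt_seven 6 (by norm_num)

/-- `ζ_sym(7,7) ≥ 126` (graft floor: `84`). [folklore] -/
theorem row_7_7 : ¬ PosRootLawAt 7 7 125 := not_posRootLawAt_seven 7 (by norm_num)

/-- `ζ_sym(8,7) ≥ 160` (graft floor: `104`). [folklore] -/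
theorem row_8_7 : ¬ PosRootLawAt 8 7 159 := not_posRootLawAt_seven 8 (by norm_num)

/-- `ζ_sym(10,7) ≥ 240` (graft floor: `150`). [folklore] -/
theorem row_10_7 : ¬ PosRootLawAt 10 7 239 := not_posRootLawAt_seven 10 (by norm_num)

/-- `ζ_sym(6,8) ≥ 102`. [folklore] -/
theorem row_6_8 : ¬ PosRootLawAt 6 8 101 := not_posRootLawAt_seven_add 6 1 (by norm_num)

/-- `ζ_sym(6,13) ≥ 192`. [folklore] -/
theorem row_6_13 : ¬ PosRootLawAt 6 13 191 := not_posRootLawAt_chain_pow 6 2 (by norm_num)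

end Summit.ValiantsHypothesis.ValiantsHypothesis.Theorems.LacunarySymmetroidMatrixDescartes.Census.Chain
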